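import Summits.AtomisticToContinuum.FouriersLaw.Theses.VanishingNoiseTransfer
import Literature.MathematicalPhysics.KineticTheory.VelocityFlipNoise
import Literature.MathematicalPhysics.KineticTheory.LangevinChainNESS

/-!
# Disproof of `NoiseLocality` (crux `stmt-AtomisticToContinuum-11975`, route VanishingNoiseTransfer) — findings

Standing-adversary work file (refuter `cdisprove`), `lean check` rc 0, sorry-free, axioms ⊆ {propext,
Classical.choice, Quot.sound}; companion evidence `HarmonicExact.lean` (in-Lean `Float` exact solve).
Index:

* §0 `NoiseLocality'` / `noiseLocality_iff` — the crux with the bound predicate `S` replaced by the tree's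
  named `OscillatorChain.IsFlipSteadyState` (definitional, `rfl`): provers may use the
  `VelocityFlipNoise.lean` API.
* §1 DEGENERATE LENGTHS: `conclusion_of_le_one` — for `N ≤ 1` the conclusion holds for EVERY `w`
  (`totalCurrent ≡ 0`, so `D0 = Dε = 0`); no counterexample below `N = 2`.
* §2 `LocalityShape D` — the response-level skeleton of the crux (a table `D ε N` of response
  coefficients, `ε = 0` the deterministic chain) and `localityShape_of_noiseLocality'`: the crux
  is exactly "the response table of the pinned chain has `LocalityShape`" once steady states are
  unique and responses exist.
* §3 KILL CRITERIA (how a refutation must look; targets for numerics / physics):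
  `not_localityShape_of_zero_mismatch` (K1: a length with `D_N(0) = 0 ≠ D_N(ε)` or vice versa),
  `not_localityShape_of_unbounded_of_bounded` (K2: `D_N(0)` unbounded in `N` while the noisy
  responses stay `≤ K` along a sequence `ε ↓ 0`), `not_localityShape_of_two_limits` (K3: two distinct
  subsequential limits of `1/D_N(0)` while the noisy resistivities converge for small `ε`).
* §4 TIGHTNESS of the route's transfer: `pointwise_modulus_insufficient` (an explicit table with a
  modulus at EVERY FIXED `N`, convergent noisy responses with limits in `(0,1]`, and oscillating
  `D_N(0)`: the `N`-uniformity of `w` cannot be dropped), `localityShape_ballistic` (the harmonic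
  corner pattern `D_N(0) = N+1 → ∞`, `D_N(ε) → 1/ε`, satisfies the shape with `w = id`: the crux
  does NOT contain finiteness of `κ(0)` — that is `VanishingNoiseBound`), `additive_form_fails_ballistic`
  (the un-weighted form `|D0 - Dε| ≤ w ε` fails in that corner: the weights `|D0||Dε|` are essential).
* §5 ENTAILMENTS the prover must be ready to prove: `ne_zero_iff_of_localityShape`
  (zero sets of `D_N(0)` and `D_N(ε)` agree: finite-`N` positivity of the deterministic response is
  part of the crux), `cauchySeq_inv_of_localityShape` (with convergent noisy responses at small
  `ε`, `1/D_N(0)` is Cauchy: the crux carries the EXISTENCE half of Fourier's law).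
* §5b CHARACTERISATION: `limits_of_localityShape` (shape + convergent noisy resistivities ⇒
  `1/D_N(0) → r₀` AND `1/κ_ε → r₀`: continuity of the conductivity at zero noise is NECESSARY — the
  sharpest physics-level kill criterion) and `localityShape_of_parts` (ROAD MAP: fixed-`N` continuity
  + continuity of `1/κ_ε` at `0⁺` + convergence of `1/D_N(ε)` uniform in `ε ∈ [0,1]` ⇒ shape).
* §6 NEAR-MISSES / why it resists (docstrings): no Lean witness of the uniqueness hypotheses exists
  for `N ≥ 2` (items `NessUnique` 0741 / `NoisyFourier` 11977 are open), so no kernel-level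
  counterexample is possible today; print + exact harmonic test bed + NEMD (compute jobs cited in
  §6) support a LINEAR modulus `w(ε) ≈ C ε`.
-/

namespace Summit.AtomisticToContinuum.FouriersLaw.Cruxes.NoiseLocality.Disproof

open Literature.MathematicalPhysics.KineticTheory.HeatConduction
open Filter Topology MeasureTheory
open Summit.AtomisticToContinuum.FouriersLaw.Theses.VanishingNoiseTransfer (NoiseLocality)

noncomputable section

/-! ## §0 The crux over the named flip-steady-state predicate -/

/-- `NoiseLocality` with the inlined predicate `S` replaced by
`OscillatorChain.IsFlipSteadyState` (and `IsSteadyState` at `ε = 0`). [folklore] -/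
def NoiseLocality' : Prop :=
  ∀ ω₂ lam β γ : ℝ, 0 < ω₂ → 0 < lam → 0 < β → 0 < γ → ∀ T : ℝ, 0 < T →
    ∃ w : ℝ → ℝ, Tendsto w (𝓝[>] 0) (𝓝 0) ∧
      ∀ (N : ℕ) (ε : ℝ), 0 < ε → ε ≤ 1 →
        ∀ μ0 με : ℝ → ℝ → Measure (PhaseSpace N),
          (∀ T_L T_R : ℝ, 0 < T_L → 0 < T_R →
              (pinnedChain ω₂ lam β γ).IsSteadyState N T_L T_R (μ0 T_L T_R) ∧
                ∀ ν, (pinnedChain ω₂ lam β γ).IsSteadyState N T_L T_R ν → ν = μ0 T_L T_R) →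
          (∀ T_L T_R : ℝ, 0 < T_L → 0 < T_R →
              (pinnedChain ω₂ lam β γ).IsFlipSteadyState N T_L T_R ε (με T_L T_R) ∧
                ∀ ν, (pinnedChain ω₂ lam β γ).IsFlipSteadyState N T_L T_R ε ν → ν = με T_L T_R) →
          ∀ D0 Dε : ℝ,
            Tendsto (fun δ : ℝ => (pinnedChain ω₂ lam β γ).totalCurrent (μ0 (T + δ / 2) (T - δ / 2)) / δ)
              (𝓝[≠] 0) (𝓝 D0) →
            Tendsto (fun δ : ℝ => (pinnedChain ω₂ lam β γ).totalCurrent (με (T + δ / 2) (T - δ / 2)) / δ)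
              (𝓝[≠] 0) (𝓝 Dε) →
            |D0 - Dε| ≤ w ε * |D0| * |Dε|

/-- The crux is definitionally its named-predicate form (the `S`-binder is discharged by `rfl`,
`OscillatorChain.isFlipSteadyState_fun_eq`). [folklore] -/
theorem noiseLocality_iff : NoiseLocality ↔ NoiseLocality' := by
  constructor
  · intro h ω₂ lam β γ hω hl hβ hγ T hT
    exact h ω₂ lam β γ hω hl hβ hγ _ rfl T hT
  · intro h ω₂ lam β γ hω hl hβ hγ S hS T hT
    subst hS
    exact h ω₂ lam β γ hω hl hβ hγ T hT

/-! ## §1 Degenerate lengths `N ≤ 1`: the conclusion is true for every modulus -/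

/-- One site: the single (would-be) bond current `j_0` has no right neighbour, so it is `0`.
[folklore] -/
theorem bondCurrent_one (P : OscillatorChain) (i : Fin 1) (x : PhaseSpace 1) :
    P.bondCurrent 1 i x = 0 := by
  simp [OscillatorChain.bondCurrent, Fin.eq_zero]

/-- One site: no bond, no current. [folklore] -/
theorem totalCurrent_one (P : OscillatorChain) (μ : Measure (PhaseSpace 1)) :
    P.totalCurrent μ = 0 := by
  simp [OscillatorChain.totalCurrent, bondCurrent_one]

/-- For `N ≤ 1` every total current vanishes. [folklore] -/
theorem totalCurrent_eq_zero_of_le_one (P : OscillatorChain) {N : ℕ} (hN : N ≤ 1)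
    (μ : Measure (PhaseSpace N)) : P.totalCurrent μ = 0 := by
  interval_cases N
  · exact P.totalCurrent_zero μ
  · exact totalCurrent_one P μ

/-- A response coefficient of a family with identically vanishing total current is `0`.
[folklore] -/
theorem response_eq_zero (P : OscillatorChain) {N : ℕ} (hN : N ≤ 1)
    (μ : ℝ → ℝ → Measure (PhaseSpace N)) (T D : ℝ)
    (hD : Tendsto (fun δ : ℝ => P.totalCurrent (μ (T + δ / 2) (T - δ / 2)) / δ) (𝓝[≠] 0) (𝓝 D)) :
    D = 0 := by
  haveI : (𝓝[≠] (0 : ℝ)).NeBot := NormedField.nhdsNE_neBot 0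
  have h : Tendsto (fun _ : ℝ => (0 : ℝ)) (𝓝[≠] (0 : ℝ)) (𝓝 D) := by
    simpa only [totalCurrent_eq_zero_of_le_one P hN, zero_div] using hD
  exact tendsto_nhds_unique h tendsto_const_nhds

/-- **No counterexample below `N = 2`.** For `N ≤ 1` the conclusion of the crux holds for every
`w`, whatever the families and whatever `ε`: both responses are `0`. [folklore] -/
theorem conclusion_of_le_one (P : OscillatorChain) {N : ℕ} (hN : N ≤ 1)
    (μ0 με : ℝ → ℝ → Measure (PhaseSpace N)) (T D0 Dε wε : ℝ)
    (h0 : Tendsto (fun δ : ℝ => P.totalCurrent (μ0 (T + δ / 2) (T - δ / 2)) / δ) (𝓝[≠] 0) (𝓝 D0))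
    (hε : Tendsto (fun δ : ℝ => P.totalCurrent (με (T + δ / 2) (T - δ / 2)) / δ) (𝓝[≠] 0) (𝓝 Dε)) :
    |D0 - Dε| ≤ wε * |D0| * |Dε| := by
  rw [response_eq_zero P hN μ0 T D0 h0, response_eq_zero P hN με T Dε hε]
  simp

/-! ## §2 The response-level skeleton -/

/-- `LocalityShape D`: the table `D ε N` (`D 0 N` = deterministic response of the `N`-chain,
`D ε N` = response with flips at rate `ε`) admits an `N`-uniform modulus:
`∃ w → 0 (ε ↓ 0), ∀ N, ∀ ε ∈ (0,1], |D 0 N - D ε N| ≤ w ε · |D 0 N| · |D ε N|`. [folklore] -/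
def LocalityShape (D : ℝ → ℕ → ℝ) : Prop :=
  ∃ w : ℝ → ℝ, Tendsto w (𝓝[>] 0) (𝓝 0) ∧
    ∀ (N : ℕ) (ε : ℝ), 0 < ε → ε ≤ 1 → |D 0 N - D ε N| ≤ w ε * |D 0 N| * |D ε N|

/-- **The crux IS the shape of the pinned chain's response table.** If at every rate `ε ∈ [0,1]`
the (flip) steady states of `pinnedChain` are unique and packaged as families `μ ε N`, with
`μ 0` the deterministic family, and `D ε N` are their response coefficients at `T`, then
`NoiseLocality'` yields `LocalityShape D`. [folklore] -/
theorem localityShape_of_noiseLocality' (h : NoiseLocality') {ω₂ lam β γ : ℝ} (hω : 0 < ω₂)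
    (hl : 0 < lam) (hβ : 0 < β) (hγ : 0 < γ) {T : ℝ} (hT : 0 < T)
    (μ : ℝ → (N : ℕ) → ℝ → ℝ → Measure (PhaseSpace N))
    (hμ : ∀ ε : ℝ, 0 ≤ ε → ε ≤ 1 → ∀ (N : ℕ) (T_L T_R : ℝ), 0 < T_L → 0 < T_R →
      (pinnedChain ω₂ lam β γ).IsFlipSteadyState N T_L T_R ε (μ ε N T_L T_R) ∧
        ∀ ν, (pinnedChain ω₂ lam β γ).IsFlipSteadyState N T_L T_R ε ν → ν = μ ε N T_L T_R)
    (D : ℝ → ℕ → ℝ)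
    (hD : ∀ ε : ℝ, 0 ≤ ε → ε ≤ 1 → ∀ N : ℕ, Tendsto
      (fun δ : ℝ => (pinnedChain ω₂ lam β γ).totalCurrent (μ ε N (T + δ / 2) (T - δ / 2)) / δ)
      (𝓝[≠] 0) (𝓝 (D ε N))) :
    LocalityShape D := by
  obtain ⟨w, hw, hloc⟩ := h ω₂ lam β γ hω hl hβ hγ T hT
  refine ⟨w, hw, fun N ε hε hε1 => ?_⟩
  refine hloc N ε hε hε1 (μ 0 N) (μ ε N) (fun T_L T_R hL hR => ?_)
    (fun T_L T_R hL hR => hμ ε hε.le hε1 N T_L T_R hL hR) _ _ (hD 0 le_rfl zero_le_one N)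
    (hD ε hε.le hε1 N)
  have h0 := hμ 0 le_rfl zero_le_one N T_L T_R hL hR
  simp only [OscillatorChain.isFlipSteadyState_zero_iff] at h0
  exact h0


/-! ## §3 Kill criteria: what a counterexample to the shape must look like -/

/-- The division-free bound forces the zero sets to agree. [folklore] -/
theorem ne_zero_iff_of_bound {D0 Dε c : ℝ} (h : |D0 - Dε| ≤ c * |D0| * |Dε|) :
    (D0 = 0 ↔ Dε = 0) := by
  constructor
  · intro h0
    rw [h0] at h
    simpa using h
  · intro h1
    rw [h1] at h
    simpa using h

/-- For non-zero responses the division-free bound is the resistivity bound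
`|1/Dε - 1/D0| ≤ c`. [folklore] -/
theorem inv_sub_inv_le_of_bound {D0 Dε c : ℝ} (h : |D0 - Dε| ≤ c * |D0| * |Dε|) (h0 : D0 ≠ 0)
    (h1 : Dε ≠ 0) : |Dε⁻¹ - D0⁻¹| ≤ c := by
  have hprod : 0 < |D0| * |Dε| := mul_pos (abs_pos.mpr h0) (abs_pos.mpr h1)
  have heq : Dε⁻¹ - D0⁻¹ = (D0 - Dε) / (D0 * Dε) := by
    field_simp
  rw [heq, abs_div, abs_mul, div_le_iff₀ hprod]
  calc |D0 - Dε| ≤ c * |D0| * |Dε| := h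
    _ = c * (|D0| * |Dε|) := by ring

/-- Conversely the resistivity bound gives the division-free bound. [folklore] -/
theorem bound_of_inv_sub_inv_le {D0 Dε c : ℝ} (h : |Dε⁻¹ - D0⁻¹| ≤ c) (h0 : D0 ≠ 0)
    (h1 : Dε ≠ 0) : |D0 - Dε| ≤ c * |D0| * |Dε| := by
  have hprod : 0 < |D0| * |Dε| := mul_pos (abs_pos.mpr h0) (abs_pos.mpr h1)
  have heq : Dε⁻¹ - D0⁻¹ = (D0 - Dε) / (D0 * Dε) := by
    field_simp
  rw [heq, abs_div, abs_mul, div_le_iff₀ hprod] at h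
  calc |D0 - Dε| ≤ c * (|D0| * |Dε|) := h
    _ = c * |D0| * |Dε| := by ring

/-- **Normal form for provers.** For a table without zeros, `LocalityShape` is an `N`-uniform
modulus of continuity at `0⁺` of the resistivities `ε ↦ 1/D ε N`. [folklore] -/
theorem localityShape_iff_resistivity {D : ℝ → ℕ → ℝ} (hD : ∀ ε N, 0 ≤ ε → ε ≤ 1 → D ε N ≠ 0) :
    LocalityShape D ↔ ∃ w : ℝ → ℝ, Tendsto w (𝓝[>] 0) (𝓝 0) ∧
      ∀ (N : ℕ) (ε : ℝ), 0 < ε → ε ≤ 1 → |(D ε N)⁻¹ - (D 0 N)⁻¹| ≤ w ε := by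
  constructor
  · rintro ⟨w, hw, h⟩
    exact ⟨w, hw, fun N ε hε hε1 => inv_sub_inv_le_of_bound (h N ε hε hε1)
      (hD 0 N le_rfl zero_le_one) (hD ε N hε.le hε1)⟩
  · rintro ⟨w, hw, h⟩
    exact ⟨w, hw, fun N ε hε hε1 => bound_of_inv_sub_inv_le (h N ε hε hε1)
      (hD 0 N le_rfl zero_le_one) (hD ε N hε.le hε1)⟩

/-- **K1 (zero mismatch).** One length `N` and one rate `ε ∈ (0,1]` at which exactly one of
`D_N(0)`, `D_N(ε)` vanishes refutes the shape — e.g. a noisy chain that conducts at a length where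
the deterministic response is `0`, or conversely. [folklore] -/
theorem not_localityShape_of_zero_mismatch {D : ℝ → ℕ → ℝ} {N : ℕ} {ε : ℝ} (hε : 0 < ε)
    (hε1 : ε ≤ 1) (h : ¬ (D 0 N = 0 ↔ D ε N = 0)) : ¬ LocalityShape D := by
  rintro ⟨w, -, hloc⟩
  exact h (ne_zero_iff_of_bound (hloc N ε hε hε1))

/-- **K2 (ballistic deterministic chain, bounded noisy conductivities).** If `|D_N(0)| → ∞`
while, for rates `ε` accumulating at `0⁺`, the noisy responses are eventually (in `N`) non-zero
and bounded by a FIXED `K`, the shape fails: it would force `1/K ≤ |w ε| + o(1)`. So for an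
anomalous deterministic chain the crux survives only if `κ_ε → ∞` as `ε ↓ 0`. [folklore] -/
theorem not_localityShape_of_unbounded_of_bounded {D : ℝ → ℕ → ℝ}
    (hdiv : Tendsto (fun N => |D 0 N|) atTop atTop) {K : ℝ} (hK : 0 < K)
    (hbdd : ∃ᶠ ε in 𝓝[>] (0 : ℝ), ∀ᶠ N in atTop, D ε N ≠ 0 ∧ |D ε N| ≤ K) :
    ¬ LocalityShape D := by
  rintro ⟨w, hw, hloc⟩
  have h1 : ∀ᶠ ε in 𝓝[>] (0 : ℝ), |w ε| < K⁻¹ / 2 := by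
    have := (Metric.tendsto_nhds.mp hw) (K⁻¹ / 2) (by positivity)
    simpa only [Real.dist_eq, sub_zero] using this
  have h2 : ∀ᶠ ε in 𝓝[>] (0 : ℝ), ε ≤ 1 := mem_nhdsWithin_of_mem_nhds (Iic_mem_nhds one_pos)
  have h3 : ∀ᶠ ε in 𝓝[>] (0 : ℝ), 0 < ε := self_mem_nhdsWithin
  obtain ⟨ε, hbε, hwε, hε1, hε⟩ := (hbdd.and_eventually (h1.and (h2.and h3))).exists
  have h4 : ∀ᶠ N in atTop, 4 * K ≤ |D 0 N| := hdiv.eventually_ge_atTop (4 * K)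
  obtain ⟨N, ⟨hne, hle⟩, hge⟩ := (hbε.and h4).exists
  have h0 : D 0 N ≠ 0 := by
    intro h
    rw [h, abs_zero] at hge
    linarith
  have key : |(D ε N)⁻¹ - (D 0 N)⁻¹| ≤ |w ε| :=
    (inv_sub_inv_le_of_bound (hloc N ε hε hε1) h0 hne).trans (le_abs_self _)
  have hi1 : K⁻¹ ≤ |(D ε N)⁻¹| := by
    rw [abs_inv]
    exact inv_anti₀ (abs_pos.mpr hne) hle
  have hi2 : |(D 0 N)⁻¹| ≤ (4 * K)⁻¹ := by
    rw [abs_inv]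
    exact inv_anti₀ (by positivity) hge
  have htri : |(D ε N)⁻¹| - |(D 0 N)⁻¹| ≤ |(D ε N)⁻¹ - (D 0 N)⁻¹| :=
    abs_sub_abs_le_abs_sub _ _
  have hK4 : (4 * K)⁻¹ = K⁻¹ / 4 := by
    rw [mul_inv]
    ring
  have hKi : 0 < K⁻¹ := inv_pos.mpr hK
  rw [hK4] at hi2
  linarith

/-- **K3 (oscillating deterministic responses).** If `1/D_N(0)` has two distinct subsequential
limits while, for all small `ε > 0`, the noisy resistivities `1/D_N(ε)` converge in `N`, the
shape fails (it would squeeze both limits within `|w ε|` of the same number). This is the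
planner's recorded failure mode "D_N(0) oscillates in N while each D_N(ε) converges".
[folklore] -/
theorem not_localityShape_of_two_limits {D : ℝ → ℕ → ℝ} {a b : ℝ} (hab : a ≠ b)
    {φ ψ : ℕ → ℕ} (hφ : Tendsto φ atTop atTop) (hψ : Tendsto ψ atTop atTop)
    (ha : Tendsto (fun k => (D 0 (φ k))⁻¹) atTop (𝓝 a))
    (hb : Tendsto (fun k => (D 0 (ψ k))⁻¹) atTop (𝓝 b)) (h0 : ∀ N, D 0 N ≠ 0)
    (hconv : ∀ᶠ ε in 𝓝[>] (0 : ℝ), (∀ N, D ε N ≠ 0) ∧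
      ∃ r : ℝ, Tendsto (fun N => (D ε N)⁻¹) atTop (𝓝 r)) :
    ¬ LocalityShape D := by
  rintro ⟨w, hw, hloc⟩
  have hηpos : 0 < |a - b| / 4 := by
    have := abs_pos.mpr (sub_ne_zero.mpr hab)
    positivity
  have h1 : ∀ᶠ ε in 𝓝[>] (0 : ℝ), |w ε| < |a - b| / 4 := by
    have := (Metric.tendsto_nhds.mp hw) (|a - b| / 4) hηpos
    simpa only [Real.dist_eq, sub_zero] using this
  have h2 : ∀ᶠ ε in 𝓝[>] (0 : ℝ), ε ≤ 1 := mem_nhdsWithin_of_mem_nhds (Iic_mem_nhds one_pos)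
  have h3 : ∀ᶠ ε in 𝓝[>] (0 : ℝ), 0 < ε := self_mem_nhdsWithin
  obtain ⟨ε, ⟨hne, r, hr⟩, hwε, hε1, hε⟩ := (hconv.and (h1.and (h2.and h3))).exists
  have hall : ∀ N, |(D ε N)⁻¹ - (D 0 N)⁻¹| ≤ |w ε| := fun N =>
    (inv_sub_inv_le_of_bound (hloc N ε hε hε1) (h0 N) (hne N)).trans (le_abs_self _)
  have hra : |r - a| ≤ |w ε| := by
    have hlim : Tendsto (fun k => |(D ε (φ k))⁻¹ - (D 0 (φ k))⁻¹|) atTop (𝓝 |r - a|) :=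
      ((hr.comp hφ).sub ha).abs
    exact le_of_tendsto' hlim fun k => hall (φ k)
  have hrb : |r - b| ≤ |w ε| := by
    have hlim : Tendsto (fun k => |(D ε (ψ k))⁻¹ - (D 0 (ψ k))⁻¹|) atTop (𝓝 |r - b|) :=
      ((hr.comp hψ).sub hb).abs
    exact le_of_tendsto' hlim fun k => hall (ψ k)
  have htri : |a - b| ≤ |r - a| + |r - b| := by
    calc |a - b| ≤ |a - r| + |r - b| := abs_sub_le a r b
      _ = |r - a| + |r - b| := by rw [abs_sub_comm a r]
  linarith

/-! ## §4 Tightness of the route's transfer -/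

/-- The oscillating table: deterministic responses `1, 3, 1, 3, …`; at rate `ε > 0` the response
equals the deterministic one while `N ε < 1` and is `1` beyond (a caricature of "noise is felt only
once the chain is longer than the flip mean free path `1/ε`"). [folklore] -/
def oscTable : ℝ → ℕ → ℝ := fun ε N =>
  if (N : ℝ) * ε < 1 then (if Even N then 1 else 3) else 1

theorem oscTable_zero (N : ℕ) : oscTable 0 N = if Even N then 1 else 3 := by
  simp [oscTable]

theorem oscTable_ne_zero (ε : ℝ) (N : ℕ) : oscTable ε N ≠ 0 := by
  unfold oscTable
  split_ifs <;> norm_num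

/-- At every positive rate the noisy responses converge (to `1 ∈ (0, 1]`). [folklore] -/
theorem tendsto_oscTable {ε : ℝ} (hε : 0 < ε) : Tendsto (oscTable ε) atTop (𝓝 1) := by
  refine tendsto_const_nhds.congr' ?_
  filter_upwards [eventually_ge_atTop ⌈ε⁻¹⌉₊] with N hN
  have hN' : ε⁻¹ ≤ (N : ℝ) := (Nat.le_ceil _).trans (by exact_mod_cast hN)
  have h1 : 1 ≤ (N : ℝ) * ε := by
    calc (1 : ℝ) = ε⁻¹ * ε := by field_simp
      _ ≤ (N : ℝ) * ε := by gcongr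
  simp [oscTable, not_lt.mpr h1]

/-- At every FIXED length the table has a modulus (even `w_N ≡ 0` near `0⁺`). [folklore] -/
theorem oscTable_pointwise_modulus (N : ℕ) : ∃ w : ℝ → ℝ, Tendsto w (𝓝[>] 0) (𝓝 0) ∧
    ∀ ε : ℝ, 0 < ε → ε ≤ 1 →
      |oscTable 0 N - oscTable ε N| ≤ w ε * |oscTable 0 N| * |oscTable ε N| := by
  refine ⟨fun ε => if (N : ℝ) * ε < 1 then 0 else 2, ?_, fun ε hε hε1 => ?_⟩
  · refine tendsto_const_nhds.congr' ?_
    have hpos : (0 : ℝ) < ((N : ℝ) + 1)⁻¹ := by positivity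
    have hmem : Set.Iio (((N : ℝ) + 1)⁻¹) ∈ 𝓝[>] (0 : ℝ) :=
      mem_nhdsWithin_of_mem_nhds (Iio_mem_nhds hpos)
    filter_upwards [hmem] with ε hε
    have hlt : (N : ℝ) * ε < 1 := by
      rcases le_or_gt ε 0 with h | h
      · calc (N : ℝ) * ε ≤ 0 := mul_nonpos_of_nonneg_of_nonpos (Nat.cast_nonneg N) h
          _ < 1 := one_pos
      · calc (N : ℝ) * ε ≤ ((N : ℝ) + 1) * ε := by nlinarith
          _ < ((N : ℝ) + 1) * ((N : ℝ) + 1)⁻¹ := by gcongr; exact hε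
          _ = 1 := by field_simp
    simp [hlt]
  · by_cases hlt : (N : ℝ) * ε < 1
    · simp [oscTable, hlt]
    · simp only [oscTable, hlt, if_false]
      split_ifs <;> norm_num

/-- The deterministic row does not converge. [folklore] -/
theorem not_tendsto_oscTable_zero : ¬ ∃ L : ℝ, Tendsto (oscTable 0) atTop (𝓝 L) := by
  rintro ⟨L, hL⟩
  have h2 : Tendsto (fun k : ℕ => 2 * k) atTop atTop :=
    tendsto_id.const_mul_atTop' two_pos
  have h21 : Tendsto (fun k : ℕ => 2 * k + 1) atTop atTop :=
    tendsto_atTop_mono (fun k => Nat.le_succ _) h2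
  have heven : Tendsto (fun k : ℕ => oscTable 0 (2 * k)) atTop (𝓝 1) := by
    refine tendsto_const_nhds.congr' (Eventually.of_forall fun k => ?_)
    simp [oscTable_zero]
  have hodd : Tendsto (fun k : ℕ => oscTable 0 (2 * k + 1)) atTop (𝓝 3) := by
    refine tendsto_const_nhds.congr' (Eventually.of_forall fun k => ?_)
    simp [oscTable_zero]
  have hL1 : L = 1 := tendsto_nhds_unique (hL.comp h2) heven
  have hL3 : L = 3 := tendsto_nhds_unique (hL.comp h21) hodd
  linarith

/-- **The `N`-uniformity of the modulus cannot be dropped** (tightness of the transfer): the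
oscillating table has a modulus at every fixed length, convergent noisy responses with limits in
`(0, 1]` at every `ε > 0`, non-vanishing entries, and yet `D_N(0)` does not converge — and
(`not_localityShape_oscTable`) it violates the uniform shape, as K3 predicts. [folklore] -/
theorem pointwise_modulus_insufficient : ∃ D : ℝ → ℕ → ℝ,
    (∀ ε : ℝ, 0 < ε → ∃ k : ℝ, 0 < k ∧ k ≤ 1 ∧ Tendsto (D ε) atTop (𝓝 k)) ∧
    (∀ N : ℕ, ∃ w : ℝ → ℝ, Tendsto w (𝓝[>] 0) (𝓝 0) ∧
      ∀ ε : ℝ, 0 < ε → ε ≤ 1 → |D 0 N - D ε N| ≤ w ε * |D 0 N| * |D ε N|) ∧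
    (∀ ε N, D ε N ≠ 0) ∧
    ¬ ∃ L : ℝ, Tendsto (D 0) atTop (𝓝 L) :=
  ⟨oscTable, fun _ hε => ⟨1, one_pos, le_rfl, tendsto_oscTable hε⟩, oscTable_pointwise_modulus,
    oscTable_ne_zero, not_tendsto_oscTable_zero⟩

/-- The oscillating table violates the uniform shape (an instance of K3 with the even/odd
subsequences). [folklore] -/
theorem not_localityShape_oscTable : ¬ LocalityShape oscTable := by
  have h2 : Tendsto (fun k : ℕ => 2 * k) atTop atTop :=
    tendsto_id.const_mul_atTop' two_pos
  have h21 : Tendsto (fun k : ℕ => 2 * k + 1) atTop atTop :=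
    tendsto_atTop_mono (fun k => Nat.le_succ _) h2
  refine not_localityShape_of_two_limits (a := 1) (b := 3⁻¹) (by norm_num) h2 h21 ?_ ?_
    (fun N => oscTable_ne_zero 0 N) ?_
  · refine tendsto_const_nhds.congr' (Eventually.of_forall fun k => ?_)
    simp [oscTable_zero]
  · refine tendsto_const_nhds.congr' (Eventually.of_forall fun k => ?_)
    simp [oscTable_zero]
  · have h3 : ∀ᶠ ε in 𝓝[>] (0 : ℝ), 0 < ε := self_mem_nhdsWithin
    filter_upwards [h3] with ε hε
    refine ⟨fun N => oscTable_ne_zero ε N, 1, ?_⟩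
    simpa using (tendsto_oscTable hε).inv₀ one_ne_zero

/-- The ballistic table: resistivity `1/D ε N = 1/(N+1) + ε` — the pattern of the pinned HARMONIC
chain with flips (`r_N(0) → 0` ballistically, `r_N(ε) → c ε`, Matthiessen exact;
Bernardin–Kannan–Lebowitz–Lukkarinen 2012 Prop. 1, Landi–de Oliveira 2013 eqs. (23)–(24)).
[folklore] -/
def ballisticTable : ℝ → ℕ → ℝ := fun ε N => (((N : ℝ) + 1)⁻¹ + ε)⁻¹

theorem ballisticTable_pos {ε : ℝ} (hε : 0 ≤ ε) (N : ℕ) : 0 < ballisticTable ε N := by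
  unfold ballisticTable
  positivity

theorem ballisticTable_zero (N : ℕ) : ballisticTable 0 N = (N : ℝ) + 1 := by
  simp [ballisticTable]

/-- **The shape holds in the ballistic corner, with the linear modulus `w = id`.** [folklore] -/
theorem localityShape_ballistic : LocalityShape ballisticTable := by
  refine ⟨id, tendsto_nhdsWithin_of_tendsto_nhds tendsto_id, fun N ε hε hε1 => ?_⟩
  refine bound_of_inv_sub_inv_le (le_of_eq ?_) (ballisticTable_pos le_rfl N).ne'
    (ballisticTable_pos hε.le N).ne'
  simp [ballisticTable, abs_of_pos hε]

/-- … while its deterministic row is unbounded (`D_N(0) = N + 1`, anomalous transport) …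
[folklore] -/
theorem tendsto_ballisticTable_zero_atTop : Tendsto (ballisticTable 0) atTop atTop := by
  have : ballisticTable 0 = fun N : ℕ => (N : ℝ) + 1 := funext ballisticTable_zero
  rw [this]
  exact tendsto_atTop_add_const_right _ 1 tendsto_natCast_atTop_atTop

/-- … and every noisy row converges, to `κ_ε = 1/ε → ∞`: so `LocalityShape` together with noisy
Fourier laws does NOT bound `D_N(0)` — the bound `κ_ε ≤ K` (`VanishingNoiseBound`) is
load-bearing in the transfer, and the crux is compatible with anomalous transport. [folklore] -/
theorem tendsto_ballisticTable {ε : ℝ} (hε : 0 < ε) : Tendsto (ballisticTable ε) atTop (𝓝 ε⁻¹) := by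
  have h1 : Tendsto (fun N : ℕ => ((N : ℝ) + 1)⁻¹) atTop (𝓝 0) :=
    tendsto_inv_atTop_zero.comp (tendsto_atTop_add_const_right _ 1 tendsto_natCast_atTop_atTop)
  have h2 : Tendsto (fun N : ℕ => ((N : ℝ) + 1)⁻¹ + ε) atTop (𝓝 ε) := by
    simpa using h1.add_const ε
  exact h2.inv₀ hε.ne'

/-- **The weights `|D0| |Dε|` are essential**: the un-weighted (additive) form
`|D 0 N - D ε N| ≤ w ε` fails for the ballistic table already at `ε = 1`, for EVERY function `w`
(no decay needed): `D_N(0) - D_N(1) ≥ N`. [folklore] -/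
theorem additive_form_fails_ballistic :
    ¬ ∃ w : ℝ → ℝ, ∀ (N : ℕ) (ε : ℝ), 0 < ε → ε ≤ 1 →
      |ballisticTable 0 N - ballisticTable ε N| ≤ w ε := by
  rintro ⟨w, h⟩
  set N := ⌈|w 1|⌉₊ + 1 with hN
  have hb := h N 1 one_pos le_rfl
  have hle1 : ballisticTable 1 N ≤ 1 := by
    unfold ballisticTable
    have : (1 : ℝ) ≤ ((N : ℝ) + 1)⁻¹ + 1 := by
      have : (0 : ℝ) ≤ ((N : ℝ) + 1)⁻¹ := by positivity
      linarith
    calc (((N : ℝ) + 1)⁻¹ + 1)⁻¹ ≤ 1⁻¹ := inv_anti₀ one_pos this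
      _ = 1 := inv_one
  have hge : (N : ℝ) ≤ |ballisticTable 0 N - ballisticTable 1 N| := by
    rw [ballisticTable_zero]
    calc (N : ℝ) ≤ (N : ℝ) + 1 - ballisticTable 1 N := by linarith
      _ ≤ |(N : ℝ) + 1 - ballisticTable 1 N| := le_abs_self _
  have hNgt : |w 1| < (N : ℝ) := by
    rw [hN]
    push_cast
    have := Nat.le_ceil (|w 1|)
    linarith
  linarith [le_abs_self (w 1)]

/-! ## §5 Entailments: what any proof of the crux must deliver -/

/-- **Zero sets agree.** Under the shape, `D_N(0) = 0 ↔ D_N(ε) = 0` for every `N` and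
`ε ∈ (0,1]`: since the noisy chain conducts at every `N ≥ 2`, the prover of the crux must supply
finite-`N` POSITIVITY (non-vanishing) of the deterministic response, an unfiled child.
[folklore] -/
theorem ne_zero_iff_of_localityShape {D : ℝ → ℕ → ℝ} (h : LocalityShape D) (N : ℕ) {ε : ℝ}
    (hε : 0 < ε) (hε1 : ε ≤ 1) : (D 0 N = 0 ↔ D ε N = 0) := by
  obtain ⟨w, -, hloc⟩ := h
  exact ne_zero_iff_of_bound (hloc N ε hε hε1)

/-- **The crux carries the existence half of Fourier's law.** Under the shape, if for all small
`ε > 0` the noisy responses are non-zero and their resistivities converge in `N` (noisy Fourier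
law), then the deterministic resistivities `1/D_N(0)` form a Cauchy (hence convergent) sequence —
no bound `K` is needed for this half. [folklore] -/
theorem cauchySeq_inv_of_localityShape {D : ℝ → ℕ → ℝ} (h : LocalityShape D)
    (hconv : ∀ᶠ ε in 𝓝[>] (0 : ℝ), (∀ N, D ε N ≠ 0) ∧
      ∃ r : ℝ, Tendsto (fun N => (D ε N)⁻¹) atTop (𝓝 r)) :
    CauchySeq fun N => (D 0 N)⁻¹ := by
  obtain ⟨w, hw, hloc⟩ := h
  have h2 : ∀ᶠ ε in 𝓝[>] (0 : ℝ), ε ≤ 1 := mem_nhdsWithin_of_mem_nhds (Iic_mem_nhds one_pos)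
  have h3 : ∀ᶠ ε in 𝓝[>] (0 : ℝ), 0 < ε := self_mem_nhdsWithin
  refine Metric.cauchySeq_iff.2 fun η hη => ?_
  have h1 : ∀ᶠ ε in 𝓝[>] (0 : ℝ), |w ε| < η / 4 := by
    have := (Metric.tendsto_nhds.mp hw) (η / 4) (by positivity)
    simpa only [Real.dist_eq, sub_zero] using this
  obtain ⟨ε, ⟨hne, r, hr⟩, hwε, hε1, hε⟩ := (hconv.and (h1.and (h2.and h3))).exists
  have h0 : ∀ N, D 0 N ≠ 0 := fun N h0 =>
    hne N ((ne_zero_iff_of_bound (hloc N ε hε hε1)).1 h0)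
  have hall : ∀ N, |(D ε N)⁻¹ - (D 0 N)⁻¹| ≤ |w ε| := fun N =>
    (inv_sub_inv_le_of_bound (hloc N ε hε hε1) (h0 N) (hne N)).trans (le_abs_self _)
  have hev : ∀ᶠ N in atTop, |(D ε N)⁻¹ - r| < η / 4 := by
    have := (Metric.tendsto_nhds.mp hr) (η / 4) (by positivity)
    simpa only [Real.dist_eq] using this
  obtain ⟨N₀, hN₀⟩ := hev.exists_forall_of_atTop
  refine ⟨N₀, fun m hm n hn => ?_⟩
  rw [Real.dist_eq]
  have hm1 : |(D 0 m)⁻¹ - (D ε m)⁻¹| ≤ |w ε| := by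
    rw [abs_sub_comm]
    exact hall m
  have hn1 := hall n
  have hm2 := hN₀ m hm
  have hn2 : |r - (D ε n)⁻¹| < η / 4 := by
    rw [abs_sub_comm]
    exact hN₀ n hn
  have t1 : |(D 0 m)⁻¹ - (D 0 n)⁻¹| ≤ |(D 0 m)⁻¹ - (D ε m)⁻¹| + |(D ε m)⁻¹ - (D 0 n)⁻¹| :=
    abs_sub_le _ _ _
  have t2 : |(D ε m)⁻¹ - (D 0 n)⁻¹| ≤ |(D ε m)⁻¹ - r| + |r - (D 0 n)⁻¹| := abs_sub_le _ _ _
  have t3 : |r - (D 0 n)⁻¹| ≤ |r - (D ε n)⁻¹| + |(D ε n)⁻¹ - (D 0 n)⁻¹| := abs_sub_le _ _ _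
  linarith

/-- Hence (ℝ complete) the deterministic resistivity converges: `1/D_N(0) → r₀` for some `r₀`;
with `VanishingNoiseBound` one gets `r₀ > 0` (the route's `closes`), without it `r₀ = 0` is
possible (`ballisticTable`). [folklore] -/
theorem tendsto_inv_of_localityShape {D : ℝ → ℕ → ℝ} (h : LocalityShape D)
    (hconv : ∀ᶠ ε in 𝓝[>] (0 : ℝ), (∀ N, D ε N ≠ 0) ∧
      ∃ r : ℝ, Tendsto (fun N => (D ε N)⁻¹) atTop (𝓝 r)) :
    ∃ r₀ : ℝ, Tendsto (fun N => (D 0 N)⁻¹) atTop (𝓝 r₀) :=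
  cauchySeq_tendsto_of_complete (cauchySeq_inv_of_localityShape h hconv)

/-! ## §5b The crux, given noisy Fourier laws, is exactly: deterministic resistivity converges +
the limiting resistivity is continuous at zero noise + equi-convergence (road map and converse) -/

/-- **Converse half (necessity).** Under the shape, if for every `ε ∈ (0,1]` the noisy resistivities
converge, `1/D_N(ε) → r ε`, then the deterministic resistivity converges to some `r₀` AND
`r ε → r₀` as `ε ↓ 0`: the crux + `NoisyFourier` force CONTINUITY OF THE CONDUCTIVITY AT ZERO NOISE,
`κ_ε → κ(0)` (in `[0, ∞]`). A printed or numerical `lim_{ε↓0} κ_ε ≠ κ(0)` would therefore refute the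
crux (this is the sharpest physics-level kill criterion; no such phenomenon is known for the pinned
anharmonic chain). [folklore] -/
theorem limits_of_localityShape {D : ℝ → ℕ → ℝ} (h : LocalityShape D) {r : ℝ → ℝ}
    (hconv : ∀ ε : ℝ, 0 < ε → ε ≤ 1 →
      (∀ N, D ε N ≠ 0) ∧ Tendsto (fun N => (D ε N)⁻¹) atTop (𝓝 (r ε))) :
    ∃ r₀ : ℝ, Tendsto (fun N => (D 0 N)⁻¹) atTop (𝓝 r₀) ∧ Tendsto r (𝓝[>] 0) (𝓝 r₀) := by
  have h2 : ∀ᶠ ε in 𝓝[>] (0 : ℝ), ε ≤ 1 := mem_nhdsWithin_of_mem_nhds (Iic_mem_nhds one_pos)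
  have h3 : ∀ᶠ ε in 𝓝[>] (0 : ℝ), 0 < ε := self_mem_nhdsWithin
  have hev : ∀ᶠ ε in 𝓝[>] (0 : ℝ), (∀ N, D ε N ≠ 0) ∧
      ∃ r' : ℝ, Tendsto (fun N => (D ε N)⁻¹) atTop (𝓝 r') := by
    filter_upwards [h2, h3] with ε hε1 hε
    exact ⟨(hconv ε hε hε1).1, r ε, (hconv ε hε hε1).2⟩
  obtain ⟨r₀, hr₀⟩ := tendsto_inv_of_localityShape h hev
  obtain ⟨w, hw, hloc⟩ := h
  refine ⟨r₀, hr₀, ?_⟩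
  -- |r ε - r₀| ≤ |w ε| for ε ∈ (0,1]
  have hle : ∀ ε : ℝ, 0 < ε → ε ≤ 1 → |r ε - r₀| ≤ |w ε| := by
    intro ε hε hε1
    obtain ⟨hne, hr⟩ := hconv ε hε hε1
    have h0 : ∀ N, D 0 N ≠ 0 := fun N h0 => hne N ((ne_zero_iff_of_bound (hloc N ε hε hε1)).1 h0)
    have hlim : Tendsto (fun N => |(D ε N)⁻¹ - (D 0 N)⁻¹|) atTop (𝓝 |r ε - r₀|) := (hr.sub hr₀).abs
    exact le_of_tendsto' hlim fun N =>
      (inv_sub_inv_le_of_bound (hloc N ε hε hε1) (h0 N) (hne N)).trans (le_abs_self _)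
  refine Metric.tendsto_nhds.mpr fun η hη => ?_
  have h1 : ∀ᶠ ε in 𝓝[>] (0 : ℝ), |w ε| < η := by
    have := (Metric.tendsto_nhds.mp hw) η hη
    simpa only [Real.dist_eq, sub_zero] using this
  filter_upwards [h1, h2, h3] with ε hwε hε1 hε
  rw [Real.dist_eq]
  exact (hle ε hε hε1).trans_lt hwε

/-- **Road map (sufficiency).** The shape FOLLOWS from: (i) fixed-`N` continuity of each resistivity
at `ε = 0⁺` (finite-dimensional perturbation theory, Hairer–Majda type); (ii) continuity at `0⁺`
of the limiting resistivity `r ε` (= `1/κ_ε`, with `r 0 = 1/κ(0)`); (iii)+(iv) convergence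
`1/D_N(ε) → r ε` UNIFORMLY in `ε ∈ [0, 1]` (at `ε = 0` this is the existence half of the
deterministic Fourier law; for `ε > 0` an equi-convergent noisy Fourier law). With
`limits_of_localityShape` and `cauchySeq_inv_of_localityShape` these parts are also necessary (given
convergent noisy resistivities), so this is what the crux IS. [folklore] -/
theorem localityShape_of_parts {D : ℝ → ℕ → ℝ} (r : ℝ → ℝ)
    (hunif : ∀ η : ℝ, 0 < η → ∃ N₀ : ℕ, ∀ N : ℕ, N₀ ≤ N → ∀ ε : ℝ, 0 ≤ ε → ε ≤ 1 →
      |(D ε N)⁻¹ - r ε| ≤ η)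
    (hcont : Tendsto r (𝓝[>] 0) (𝓝 (r 0)))
    (hfix : ∀ N : ℕ, Tendsto (fun ε => (D ε N)⁻¹) (𝓝[>] 0) (𝓝 (D 0 N)⁻¹))
    (hD : ∀ (ε : ℝ) (N : ℕ), 0 ≤ ε → ε ≤ 1 → D ε N ≠ 0) :
    LocalityShape D := by
  -- the discrepancy table and its supremum over N
  set g : ℝ → ℕ → ℝ := fun ε N => |(D ε N)⁻¹ - (D 0 N)⁻¹| with hg
  have g_nonneg : ∀ ε N, 0 ≤ g ε N := fun ε N => abs_nonneg _
  -- a tail bound valid for all ε ∈ [0,1]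
  have tail : ∀ η : ℝ, 0 < η → ∃ N₀ : ℕ, ∀ N : ℕ, N₀ ≤ N → ∀ ε : ℝ, 0 ≤ ε → ε ≤ 1 →
      g ε N ≤ 2 * η + |r ε - r 0| := by
    intro η hη
    obtain ⟨N₀, hN₀⟩ := hunif η hη
    refine ⟨N₀, fun N hN ε hε hε1 => ?_⟩
    have a := hN₀ N hN ε hε hε1
    have b := hN₀ N hN 0 le_rfl zero_le_one
    have t1 : g ε N ≤ |(D ε N)⁻¹ - r ε| + |r ε - (D 0 N)⁻¹| := abs_sub_le _ _ _
    have t2 : |r ε - (D 0 N)⁻¹| ≤ |r ε - r 0| + |r 0 - (D 0 N)⁻¹| := abs_sub_le _ _ _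
    rw [abs_sub_comm] at b
    linarith
  have hbdd : ∀ ε : ℝ, 0 ≤ ε → ε ≤ 1 → BddAbove (Set.range (g ε)) := by
    intro ε hε hε1
    obtain ⟨N₀, hN₀⟩ := tail 1 one_pos
    have hfin : BddAbove ((g ε) '' Set.Iio N₀) := ((Set.finite_Iio N₀).image _).bddAbove
    have htail : BddAbove ((g ε) '' Set.Ici N₀) :=
      ⟨2 * 1 + |r ε - r 0|, by
        rintro _ ⟨N, hN, rfl⟩
        exact hN₀ N hN ε hε hε1⟩
    refine (hfin.union htail).mono ?_
    rintro _ ⟨N, rfl⟩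
    rcases lt_or_ge N N₀ with hN | hN
    · exact Or.inl ⟨N, hN, rfl⟩
    · exact Or.inr ⟨N, hN, rfl⟩
  refine ⟨fun ε => ⨆ N, g ε N, ?_, fun N ε hε hε1 => ?_⟩
  · -- the modulus tends to 0
    refine Metric.tendsto_nhds.mpr fun η hη => ?_
    obtain ⟨N₀, hN₀⟩ := tail (η / 8) (by positivity)
    have hc : ∀ᶠ ε in 𝓝[>] (0 : ℝ), |r ε - r 0| < η / 4 := by
      have := (Metric.tendsto_nhds.mp hcont) (η / 4) (by positivity)
      simpa only [Real.dist_eq] using this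
    have hf : ∀ᶠ ε in 𝓝[>] (0 : ℝ), ∀ N ∈ Finset.range N₀, g ε N < η / 2 := by
      refine (eventually_all_finset (Finset.range N₀)).mpr fun N _ => ?_
      have h0 : Tendsto (fun ε => g ε N) (𝓝[>] 0) (𝓝 0) := by
        have := ((hfix N).sub_const (D 0 N)⁻¹).abs
        simpa [hg] using this
      have := (Metric.tendsto_nhds.mp h0) (η / 2) (by positivity)
      simpa only [Real.dist_eq, sub_zero, abs_of_nonneg (g_nonneg _ N)] using this
    have h2 : ∀ᶠ ε in 𝓝[>] (0 : ℝ), ε ≤ 1 := mem_nhdsWithin_of_mem_nhds (Iic_mem_nhds one_pos)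
    have h3 : ∀ᶠ ε in 𝓝[>] (0 : ℝ), 0 < ε := self_mem_nhdsWithin
    filter_upwards [hc, hf, h2, h3] with ε hcε hfε hε1 hε
    have hall : ∀ N, g ε N ≤ η / 2 := by
      intro N
      rcases lt_or_ge N N₀ with hN | hN
      · exact (hfε N (Finset.mem_range.mpr hN)).le
      · have := hN₀ N hN ε hε.le hε1
        linarith
    have hsup : (⨆ N, g ε N) ≤ η / 2 := ciSup_le hall
    have hsup0 : 0 ≤ ⨆ N, g ε N := le_ciSup_of_le (hbdd ε hε.le hε1) 0 (g_nonneg ε 0)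
    rw [Real.dist_eq, sub_zero, abs_of_nonneg hsup0]
    linarith
  · -- the bound itself
    have hgle : g ε N ≤ ⨆ N, g ε N := le_ciSup (hbdd ε hε.le hε1) N
    exact bound_of_inv_sub_inv_le hgle (hD 0 N le_rfl zero_le_one) (hD ε N hε.le hε1)

/-! ## §6 Near-misses and why the crux resists (cycle 1, 2026-08-15)

**No kernel-level counterexample is possible today.** A refutation `¬ NoiseLocality` must EXHIBIT,
for some `N ≥ 2` (§1 disposes of `N ≤ 1`), the unique deterministic steady family `μ0` and the
unique flip-noisy family `με` of `pinnedChain` at all `T_L, T_R > 0` together with their response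
limits — i.e. it needs uniqueness of weak stationary Fokker–Planck solutions of a hypoelliptic
diffusion with cubic drift (item `NessUnique`, stmt-0741, open; noisy analogue = clause (i) of
`NoisyFourier`, stmt-11977, open) AND a closed form for `D_N(ε)`, which does not exist for any
anharmonic chain. The hypotheses are therefore unwitnessable in Lean for `N ≥ 2`; every attack
below is at the level of the response table (§2–§5) or numerical / printed evidence.

**Physics-level attacks tried (none bites).**
* K1 (zero mismatch) needs a length `N ≥ 2` with `D_N(0) = 0 < D_N(ε)`: excluded heuristically by
  strict positivity of entropy production of the deterministic NESS at `T_L ≠ T_R` and the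
  finite-`N` Green–Kubo formula (Bonetto–Lebowitz–Rey-Bellet 2000 §6.3, eqs. (34)–(35), as vendored
  in `Literature/Barriers/AtomisticToContinuum/FixedLengthNoConductivityControl.lean`); not
  provable here, not refutable.
* K2 (anomalous deterministic chain with `κ_ε ≤ K`): the pinned chain breaks momentum conservation
  and normal conductivity is the printed expectation (BLR 2000 §10 item 1, quoted in
  `FouriersLaw.lean`; kinetic-theory refs to be re-checked when `lit` is back: Aoki–Lukkarinen–Spohn
  2006, Lefevere–Schenkel 2006); and even if `κ(0) = ∞`, flips only ADD scattering, so `κ_ε → ∞` is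
  the expected behaviour (the ballistic harmonic corner realises exactly this and SATISFIES the
  shape, `localityShape_ballistic`).
* K3 (oscillating `D_N(0)`): no parity / commensurability mechanism in a homogeneous chain with a
  unique, exponentially mixing finite-`N` NESS; boundary (contact) resistances are `O(1)` and enter
  `1/D_N = R_N/(N-1)` with weight `1/(N-1)`.
* Matthiessen heuristics: `1/κ_ε ≈ 1/κ_0 + c_flip ε` with `c_flip = 2 + ν² + √(ν²(ν²+4))` up to
  the factor-2 flip-rate convention (`ν² = ω₂`; Bernardin–Kannan–Lebowitz–Lukkarinen 2012
  arXiv:1110.5432 Prop. 1 as read by grounder g28-0 on the item: flip-limited resistivity of the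
  harmonic pinned chain; the convention is settled by j004863), nearly `T`-independent: predicts a
  LINEAR modulus `w(ε) ≈ C ε`, `C = O(5–10)`, at every temperature although `κ_0(T)` varies by
  orders of magnitude — a falsifiable prediction tested by the NEMD jobs (plan B, `T ∈ {0.3, 1, 3}`).
* Printed harmonic test bed (grounders g28-0/1 on the item): Landi–de Oliveira 2013 eqs. (23)–(24)
  give `1/D_N(λ) - 1/D_N(0) = λ N/(A(N-1))`, `N`-uniform and linear; BKLL2012 Prop. 1 the closed form.

**Small-model computation done in-session (Lean `Float`, `lean check` of `HarmonicExact.lean`,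
attached as item evidence; exact second-moment solve of the pinned HARMONIC chain `pinnedChain ω₂ 0 0 γ`
+ baths + flips at every site, i.e. the crux's own generator at `lam = β = 0`; `Δ_N(ε)/ε`,
`Δ_N(ε) = 1/D_N(ε) - 1/D_N(0)`):**
```
ω₂=1, γ=1      ε=0.01   0.05   0.1    0.2    0.5    1.0      D_N(0)
  N=2           8.000  8.000  8.000  8.000  8.000  8.000     0.1667
  N=3           8.671  8.689  8.709  8.746  8.821  8.882     0.2727
  N=4           8.937  8.979  9.026  9.101  9.233  9.326     0.3837
  N=6           9.430  9.464  9.506  9.575  9.689  9.764     0.6259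
  N=8           9.751  9.755  9.778  9.827  9.911  9.965     0.8751
  N=10          9.941    -    9.933    -      -   10.078     1.1250
  N=12         10.061    -   10.032    -      -   10.149     1.3750
  N→∞ (BKLL)   10.472 = 2(2+ν²+√(ν²(ν²+4))), ν² = ω₂  [flip resistivity in the crux's rate convention]
ω₂=4, γ=1:    N=2: 20.000 (all ε) … N=8: 22.33 (ε=.01) → 2(6+√32) = 23.31
ω₂=1/4, γ=1:  N=2: 5.000 (all ε) … N=12: 6.21 (ε=.01) → 2(2.25+√1.0625) = 6.56
ω₂=1, γ=0.2:  N=2: 8.000; N=4: 10.86/9.98/9.36; N=6: 11.67/9.84/9.62; N=8: 11.50/9.69/9.78 (ε=.01/.1/.5)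
```
Findings: (1) the modulus is LINEAR and `N`-UNIFORM in the harmonic corner, `sup_N Δ_N(ε)/ε` finite
for every `ε ∈ (0,1]` and essentially `ε`-independent: `w(ε) = C ε` with
`C ≈ max(4(1+ω₂), 2(2+ω₂+√(ω₂(ω₂+4)))) (1 + O(ε))` (plus an `O(1)` contact overshoot at weak bath
coupling, `γ = 0.2`: 11.7 at `N = 6`); (2) `N = 2` is EXACTLY Matthiessen: `1/D_2(ε) - 1/D_2(0) =
4(1+ω₂) ε` for all `ε, γ` tested (both sites are bath sites); (3) `D_N(0) ≈ (N-1)/8` grows ballistically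
while `Δ_N(ε)/ε` increases monotonically (γ = 1) to the bulk flip resistivity — the `ballisticTable`
pattern of §4 with `w = 10.47 ε`; (4) rate convention settled: in the crux's convention (generator
`ε Σ_i (f∘Θ_i - f)`) the bulk flip resistivity at `ω₂ = 1` is `10.47 = 2 × 5.236`, i.e. BKLL's `γ`
is `2ε`.

**Print, nearest model (read this cycle):** Guimarães–Landi–de Oliveira 2015 (PRE 92, 062120;
arXiv:1511.06595 §2–§4): φ⁴ chains (quartic PINNING `g x⁴/4`, harmonic coupling, Langevin baths
`α = 0.1`, flips at every site at rate `λ`) — "for sufficiently large `L` the flux is diffusive,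
`J ∼ 1/L`" at every `λ ≥ 0` and "`J = b/(λL)`" for large `λ, L` (flip-dominated resistivity, linear in
`λ`); their headline effect (rectification `R_∞(λ) > 0` for `λ > 0`, `= 0` at `λ = 0`, for halves
with pinning `g_L ≠ g_R`) is exactly what Matthiessen `1/κ_{g,λ}(T) = 1/κ_g(T) + c λ` with a
`T`-INDEPENDENT flip resistivity predicts (two Fourier segments whose `κ`-ratio is `T`-independent do
not rectify; the additive `cλ` breaks the common `T`-scaling), and `R_∞(λ) = O(λ) → 0`: no
discontinuity at zero noise, i.e. no K-signature; rather support for the additive-resistivity picture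
behind the crux. No printed `λ → 0` study of the LINEAR response of a pinned anharmonic chain exists
(grounders g28-0/1/2; crossref re-checked this cycle, openalex/s2/arxiv rate-limited).

**NEMD jobs (kit compute; starved in the queue at priority 79→85 for > 6 h at the time of writing;
left queued, they auto-attach to the item and will be folded in at the next re-arm):**
* `[compute j004863]` exact sparse second-moment solve, harmonic, `N ≤ 256`, `ε ∈ [10⁻³, 1]`, five
  `(ω₂, γ)` (extends the table above to the thermodynamic crossover `N ε ≫ 1`).
* `[compute j004867]` NEMD `pinnedChain(1,1,1,1)`, `T = 1`, `δ = 0.4`: `D_N(ε)`, `N ∈ {2,…,128}`,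
  `ε ∈ {0, .01, .02, .05, .1, .2, .5, 1}`; checks (`δ = 0.2`, `h = 0.01`, equilibrium, harmonic
  cross-validation); one-scatterer added resistance vs `N` (sitewise locality).
* `[compute j004868]` `N ∈ {192, 256}` at `T = 1`; `T ∈ {0.3, 3}` sweeps. `[compute j005233]`
  corners: `(1,1,0.05,1)` at `T = 4`, `(1,4,1,1)`, `(1,1,1,0.2)` at `T = 1`.
Decision rule: the crux RESISTS numerically if `sup_N |Δ_N(ε)|/ε` stays `O(10)` down to `ε = 0.01`
with `D_N(ε)` monotone in `ε`; K2/K3 ALARM if it grows (≳ 3×) as `ε ↓ 0` beyond error bars or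
`argmax_N` runs to the largest `N` with growing value; K1 ALARM on any sign change / vanishing `D`.

**Targets (pre-emptive; no stubs assigned to this seat yet).** The crux directory now holds the line
`Lines/fekete-transposed-uniformity.lean` (6 stubs; composition `NoiseLocality_of` sorry-free). Its only
NEW load is `stub_uniformSeriesLawPositiveNoise` (one junction constant `C(T)` for the two-sided series law
`|R_{N+M}(ε) − R_N(ε) − R_M(ε)| ≤ C`, `R_N := (N−1)/D_N(ε)`, uniformly in `ε ∈ (0,1]`). Harmonic-corner
calibration with the in-Lean exact solver (`HarmonicExact3.lean`, ω₂ = γ = 1; defect `R_{N+M} − R_N − R_M`):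
```
 (N,M):   (2,2)  (2,3)  (3,3)  (2,4)  (3,4)  (4,4)  (2,6)  (4,6)  (5,5)  (6,6)
 ε=0     -4.18  -5.38  -6.68  -5.83  -7.15  -7.64  -5.99  -7.81  -7.91  -7.98
 ε=0.01  -4.07  -5.27  -6.55  -5.71  -7.02  -7.49  -5.86  -7.65  -7.75  -7.81
 ε=0.1   -3.07  -4.20  -5.41  -4.58  -5.81  -6.21  -4.70  -6.33  -6.40  -6.45
 ε=0.5   +1.67  +0.81  -0.10  +0.54  -0.37  -0.65  +0.47  -0.72  -0.77  -0.79
 ε=1     +7.80  +7.23  +6.61  +7.01  +6.39  +6.16  +6.95  +6.09  +6.05  +6.03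
```
PASSES: `|defect| ≤ 8 = R_∞(0)` (the ballistic saturation value of the bath-to-bath resistance,
`R_N(0) = 6, 7.33, 7.82, …, 7.99995 (N=10) → 8`) uniformly in `ε ∈ [0,1]`; the defect is `≈ −R_∞(0)` as
`ε → 0` (re-thermalising a cut costs two contacts) and changes SIGN between `ε = 0.1` and `0.5` — a prover
must not hope for a one-signed (purely sub- or super-additive) law uniformly in `ε`.
SITEWISE LOCALITY (route plan (a), "one extra scatterer changes the total resistance by O(1)"): flips at
rate `λ` at the single site `x = N/2` (resp. the bath site `x = 0`), added total resistance
`(N−1)(1/D^x_N − 1/D_N(0))`: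
```
 N:            4      6      8      10     12
 λ=0.3 mid    2.60   3.04   3.15   3.17   3.18     → ≈ 3.19 = 0.3 × 10.6
 λ=1   mid    8.81  10.16  10.47  10.54  10.55     → ≈ 10.6 ≈ 2(3+√5) (bulk flip resistivity per unit rate)
 λ=1   x=0    5.07   5.04   5.03   5.03   5.03     (bath site: half)
```
`N`-independent and LINEAR in the rate: in the harmonic corner Matthiessen is sitewise-exact to within a
few % (`ΔR ≈ c_flip Σ_x λ_x`), which is the strongest form of the locality the crux needs; the anharmonic
analogue is what the starved NEMD job j004867 (single-site block) measures.

**Gate note.** The abstract lemmas of §3–§5 were offered as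
`Theorems/NoiseLocalityNegativeCriteria.lean --supports stmt-11975`; the gate bounces any refuter
file that is not `¬ <Theses decl>` (`theorems.refuter`), so they travel as item evidence (this file).
-/

end

end Summit.AtomisticToContinuum.FouriersLaw.Cruxes.NoiseLocality.Disproof
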